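import Summits.BirchSwinnertonDyer.BirchSwinnertonDyer.Theorems.CyclotomicUntwistPSUntwistedTrace
import Summits.BirchSwinnertonDyer.BirchSwinnertonDyer.Theorems.CyclotomicUntwistPSTwistInvolutionUnitPart
import HarnessLib

/-!
# LAW L-a3 × LAW L-tw3 (kernel): the untwisted trace `a_w` is CONSTANT on `χ₋₃`-twist pairs and ODD under the
# `χ₃`-twist on the principal-series rows (route `CyclotomicUntwist`, cruxes K1 `PSRankOneLowerHalfAtThree` / K2)

Cell `pub/bsd-wall` (D-0145 line `route-BirchSwinnertonDyer-CyclotomicUntwist`), seat `bsd-line-cycu-p3` (gen 6).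
Helper toward K1 (stmt-BirchSwinnertonDyer-21580) / K2 (stmt-21581). THEOREMS ONLY (no definition, no named fact,
no `sorry`); BSD is not proved by this file and no crux is.

WHY. LAW L-tw3 (`CyclotomicUntwistPSTwistInvolution*`, cycu-p4 g5): on the cyclic wild cell the `±3`-twist
`C • V^{(±3)} = W` is an involution `II ↔ IV*`, `IV ↔ II*` preserving the principal-series predicate; its READING is
that a pair `(E, E ⊗ χ₋₃)` shares ONE untwist newform `g` (`η₆ = η₃·χ₋₃`), hence one `U₃`-root `α` and one trace
`a₃(g) + a₃(ḡ)`. LAW L-a3 (T) says that trace is `a_w`. So (T) PREDICTS `a_w(E ⊗ χ₋₃) = a_w(E)` — and, since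
`E ⊗ χ₃ = (E ⊗ χ₋₃) ⊗ χ₋₁` is the unramified quadratic twist over `ℚ₃(ζ₉) ∋ √−3`, `a_w(E ⊗ χ₃) = −a_w(E)`
(memo LAW-La3-KERNEL-v3 (C)). This file VERIFIES both on the typed closed form `W.psUntwistedTrace`
(`CyclotomicUntwistPSUntwistedTraceDefs`, p616806), for every curve on a principal-series row:

* §1 `num_pow_mul_c₆_twist_eq` — the twist relation on `c₆` cleared of denominators:
  `N⁶·c₆(W_ℤ) = d³·c₆(V_ℤ)·M⁶` (`u(C) = N/M`); `pow_six_emod_nine`; **`c₆_unitPart_twist_zmod_nine`**: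
  `c₆ᵘ(W) ≡ (d/3)·c₆ᵘ(V) (mod 9)` for `d = ±3` (strip the powers of `3`, `x⁶ ≡ 1 (mod 9)`);
* §2 residue tables under negation: `signNine_neg_emod`, `traceTableIV_neg_emod`;
* §3 **`psUntwistedTrace_twist_negThree_of_psRow : a_w(W) = a_w(V)`** for `C • V^{(−3)} = W` and
  **`psUntwistedTrace_twist_three_of_psRow : a_w(W) = −a_w(V)`** for `C • V^{(3)} = W`, `V` on a PS row
  (`ClassO6 V 3`, `v₃Δ_min` even, `Δ′ ≡ 1 (mod 3)`); summary `psUntwistedTrace_twist_of_psRow`.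

So the a_w-trichotomy of the 416 K1/K2 classes (`+3 / 0 / −3 : 144 / 133 / 139`, K1-ROW-ATLAS-v1) is constant on
the χ₋₃-pairs inside the rows (cycu-p4's TWIST-PAIRS-416), as one `g` per pair requires. Informal, not asserted:
the identification of `a_w` with `a₃(g) + a₃(ḡ)`.

References: A. Kraus, Manuscripta Math. 69 (1990), Théorème (p = 3) [Kraus1990]; J. H. Silverman, *AEC* III.1,
VII.1 Prop. 1.3, X.2 Prop. 2.4 [SilvermanAEC2009]; D. Rohrlich, *Elliptic curves and the Weil–Deligne group*,
CRM Proc. Lecture Notes 4 (1994), §§15–19 [Rohrlich1994CRM].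
-/

open scoped Classical

open WeierstrassCurve IsDedekindDomain Rat.HeightOneSpectrum Literature.NumberTheory.EllipticCurves
  Literature.NumberTheory.EllipticCurves.Rank1Residual Literature.NumberTheory.DiophantineGeometry
  Summit.BirchSwinnertonDyer.Rank1Residual.Additive
  Summit.BirchSwinnertonDyer.BirchSwinnertonDyer.Theorems

-- single-conjunct summit: `Summit.BirchSwinnertonDyer.BirchSwinnertonDyer.…` repeats the name by design
set_option linter.dupNamespace false
set_option autoImplicit false

namespace Summit.BirchSwinnertonDyer.BirchSwinnertonDyer.Theorems.PSUntwistedTrace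

/-! ### §1 The unit part of `c₆` across a `±3`-twist -/

section UnitPart

/-- Sixth powers of integers prime to `3` are `≡ 1 (mod 9)` (`(ℤ/9)ˣ` is cyclic of order `6`). [folklore] -/
private theorem pow_six_zmod_nine : ∀ x : ZMod 9,
    ZMod.castHom (show 3 ∣ 9 by norm_num) (ZMod 3) x ≠ 0 → x ^ 6 = 1 := by
  decide

/-- Sixth powers of integers prime to `3` are `≡ 1 (mod 9)`. [folklore] -/
theorem pow_six_emod_nine {n : ℤ} (hn : ¬ (3 : ℤ) ∣ n) : ((n ^ 6 : ℤ) : ZMod 9) = 1 := by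
  have h : ZMod.castHom (show 3 ∣ 9 by norm_num) (ZMod 3) (n : ZMod 9) ≠ 0 := by
    rw [map_intCast, Ne, ZMod.intCast_zmod_eq_zero_iff_dvd]; exact_mod_cast hn
  have := pow_six_zmod_nine _ h
  push_cast
  exact this

/-- **Cancellation of sixth powers modulo `9`.** `A·n⁶ = B·m⁶` in `ℤ` with `3 ∤ nm` ⟹ `A ≡ B (mod 9)`. [folklore] -/
theorem intCast_zmod_nine_eq_of_mul_pow_six {A B n m : ℤ} (hn : ¬ (3 : ℤ) ∣ n) (hm : ¬ (3 : ℤ) ∣ m)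
    (h : A * n ^ 6 = B * m ^ 6) : (A : ZMod 9) = (B : ZMod 9) := by
  have h' := congrArg (Int.cast : ℤ → ZMod 9) h
  push_cast at h'
  have hn1 := pow_six_emod_nine hn
  have hm1 := pow_six_emod_nine hm
  push_cast at hn1 hm1
  rw [hn1, hm1, mul_one, mul_one] at h'
  exact h'

variable (V W : WeierstrassCurve ℚ) [V.IsElliptic] [V.IsGloballyMinimal] [W.IsElliptic] [W.IsGloballyMinimal]

omit [V.IsElliptic] [W.IsElliptic] in
/-- The twist relation on `c₆`, CLEARED OF DENOMINATORS: with `u(C) = N/M` in lowest terms,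
`N⁶ · c₆(W_ℤ) = d³ · c₆(V_ℤ) · M⁶` in `ℤ` (`c₆(C • X) = u⁻⁶ c₆(X)`, `c₆(V^{(d)}) = d³ c₆(V)`; any `d ∈ ℤ`).
[cite: SilvermanAEC2009, III.1 Table 3.1 and X.2 Prop. 2.4] -/
theorem num_pow_mul_c₆_twist_eq {d : ℤ} (C : VariableChange ℚ) (hC : C • V.quadraticTwist (d : ℚ) = W) :
    (C.u : ℚ).num ^ 6 * (integralModelInt W).c₆ = d ^ 3 * (integralModelInt V).c₆ * (C.u : ℚ).den ^ 6 := by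
  have hden : ((C.u : ℚ).den : ℚ) ≠ 0 := by exact_mod_cast (C.u : ℚ).den_nz
  have h6 : (((integralModelInt W).c₆ : ℤ) : ℚ) = (C.u : ℚ)⁻¹ ^ 6 * ((d : ℚ) ^ 3 * (integralModelInt V).c₆) := by
    rw [← PSRootNumberThree.c₆_eq_cast_integralModelInt W, ← PSRootNumberThree.c₆_eq_cast_integralModelInt V,
      ← hC, variableChange_c₆, quadraticTwist_c₆, Units.val_inv_eq_inv_val]
  have key : ((C.u : ℚ).num : ℚ) ^ 6 * (integralModelInt W).c₆ =
      (d : ℚ) ^ 3 * (integralModelInt V).c₆ * ((C.u : ℚ).den : ℚ) ^ 6 := by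
    rw [h6]
    have hnum : ((C.u : ℚ).num : ℚ) = (C.u : ℚ) * (C.u : ℚ).den := (Rat.mul_den_eq_num _).symm
    rw [hnum]
    field_simp
  exact_mod_cast key

omit [V.IsElliptic] [W.IsElliptic] in
/-- **The unit parts of `c₆` across a `±3`-twist: `c₆ᵘ(W) ≡ (d/3)·c₆ᵘ(V) (mod 9)`** for `C • V^{(d)} = W`,
`d = ±3`, both curves globally minimal with `c₆ ≠ 0` (`c₆ᵘ := c₆(·_ℤ)/3^{v₃ c₆(·_ℤ)}`): from
`N⁶·c₆(W_ℤ) = ±27·c₆(V_ℤ)·M⁶` strip the powers of `3` and use `x⁶ ≡ 1 (mod 9)`.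
[cite: SilvermanAEC2009, X.2 Prop. 2.4 and VII.1 Prop. 1.3] -/
theorem c₆_unitPart_twist_zmod_nine {d : ℤ} (hd : d = 3 ∨ d = -3) (C : VariableChange ℚ)
    (hC : C • V.quadraticTwist (d : ℚ) = W) (hV0 : (integralModelInt V).c₆ ≠ 0) (hW0 : (integralModelInt W).c₆ ≠ 0) :
    (((integralModelInt W).c₆ / 3 ^ padicValInt 3 (integralModelInt W).c₆ : ℤ) : ZMod 9) =
      ((d / 3 : ℤ) : ZMod 9) * (((integralModelInt V).c₆ / 3 ^ padicValInt 3 (integralModelInt V).c₆ : ℤ) : ZMod 9) := by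
  have hZ := num_pow_mul_c₆_twist_eq V W C hC
  have hu0 : (C.u : ℚ) ≠ 0 := C.u.ne_zero
  have hN0 : (C.u : ℚ).num ≠ 0 := Rat.num_ne_zero.mpr hu0
  have hM0 : ((C.u : ℚ).den : ℤ) ≠ 0 := by exact_mod_cast (C.u : ℚ).den_nz
  obtain ⟨N', hN, hN'⟩ := PSRootNumberThreeTable.exists_eq_pow_mul_not_dvd hN0
  obtain ⟨M', hM, hM'⟩ := PSRootNumberThreeTable.exists_eq_pow_mul_not_dvd hM0
  obtain ⟨cV, hcV, hcV'⟩ := PSRootNumberThreeTable.exists_eq_pow_mul_not_dvd hV0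
  obtain ⟨cW, hcW, hcW'⟩ := PSRootNumberThreeTable.exists_eq_pow_mul_not_dvd hW0
  have hqV : (integralModelInt V).c₆ / 3 ^ padicValInt 3 (integralModelInt V).c₆ = cV :=
    Int.ediv_eq_of_eq_mul_right (pow_ne_zero _ (by norm_num)) hcV
  have hqW : (integralModelInt W).c₆ / 3 ^ padicValInt 3 (integralModelInt W).c₆ = cW :=
    Int.ediv_eq_of_eq_mul_right (pow_ne_zero _ (by norm_num)) hcW
  rw [hqV, hqW]
  -- `d = 3ε`, `ε = ±1`, `d/3 = ε`, `d³ = 27 ε`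
  obtain ⟨ε, hε, hdε⟩ : ∃ ε : ℤ, (ε = 1 ∨ ε = -1) ∧ d = 3 * ε := by
    rcases hd with rfl | rfl
    · exact ⟨1, Or.inl rfl, by norm_num⟩
    · exact ⟨-1, Or.inr rfl, by norm_num⟩
  have hd3 : d / 3 = ε := by rw [hdε]; simp
  have hε3 : ¬ (3 : ℤ) ∣ ε := by rcases hε with rfl | rfl <;> decide
  rw [hd3]
  set a := padicValInt 3 (C.u : ℚ).num
  set b := padicValInt 3 ((C.u : ℚ).den : ℤ)
  set kV := padicValInt 3 (integralModelInt V).c₆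
  set kW := padicValInt 3 (integralModelInt W).c₆
  have hL : (C.u : ℚ).num ^ 6 * (integralModelInt W).c₆ = 3 ^ (6 * a + kW) * (N' ^ 6 * cW) := by
    rw [hN, hcW]; ring
  have hR : d ^ 3 * (integralModelInt V).c₆ * ((C.u : ℚ).den : ℤ) ^ 6 =
      3 ^ (3 + kV + 6 * b) * (ε ^ 3 * cV * M' ^ 6) := by
    rw [hdε, hM, hcV]; ring
  have h3p : Prime (3 : ℤ) := Int.prime_three
  have hLu : ¬ (3 : ℤ) ∣ N' ^ 6 * cW := fun h ↦ by
    rcases h3p.dvd_or_dvd h with h | h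
    · exact hN' (h3p.dvd_of_dvd_pow h)
    · exact hcW' h
  have hRu : ¬ (3 : ℤ) ∣ ε ^ 3 * cV * M' ^ 6 := fun h ↦ by
    rcases h3p.dvd_or_dvd h with h | h
    · rcases h3p.dvd_or_dvd h with h | h
      · exact hε3 (h3p.dvd_of_dvd_pow h)
      · exact hcV' h
    · exact hM' (h3p.dvd_of_dvd_pow h)
  have hkL := PSTamagawaThree.padicValInt_three_eq_of_eq_pow_mul (6 * a + kW) hL hLu
  have hkR := PSTamagawaThree.padicValInt_three_eq_of_eq_pow_mul (3 + kV + 6 * b) hR hRu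
  have hk : 6 * a + kW = 3 + kV + 6 * b := by rw [← hkL, ← hkR, hZ]
  have hcore : N' ^ 6 * cW = ε ^ 3 * cV * M' ^ 6 := by
    have h := hZ
    rw [hL, hR, hk] at h
    exact mul_left_cancel₀ (pow_ne_zero _ (by norm_num)) h
  have hε3' : ε ^ 3 = ε := by rcases hε with rfl | rfl <;> norm_num
  have := intCast_zmod_nine_eq_of_mul_pow_six (A := cW) (B := ε * cV) hN' hM' (by rw [← hε3', ← hcore]; ring)
  rw [this]; push_cast; ring

end UnitPart

/-! ### §2 The residue tables under `c₆ᵘ ↦ −c₆ᵘ` -/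

section Tables

/-- `s((−x) mod 9) = −s(x mod 9)` when `x ≡ ±4 (mod 9)`. [folklore] -/
theorem signNine_neg_emod {x : ℤ} (h : x % 9 = 4 ∨ x % 9 = 5) : signNine ((-x) % 9) = -signNine (x % 9) := by
  rcases h with h | h
  · rw [h, show (-x) % 9 = 5 by omega]; decide
  · rw [h, show (-x) % 9 = 4 by omega]; decide

/-- `T((−x) mod 9) = −T(x mod 9)` for `3 ∤ x`. [folklore] -/
theorem traceTableIV_neg_emod {x : ℤ} (h : ¬ (3 : ℤ) ∣ x) : traceTableIV ((-x) % 9) = -traceTableIV (x % 9) := by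
  rcases emod_nine_of_not_three_dvd h with h | h | h | h | h | h
  · rw [h, show (-x) % 9 = 8 by omega]; decide
  · rw [h, show (-x) % 9 = 7 by omega]; decide
  · rw [h, show (-x) % 9 = 5 by omega]; decide
  · rw [h, show (-x) % 9 = 4 by omega]; decide
  · rw [h, show (-x) % 9 = 2 by omega]; decide
  · rw [h, show (-x) % 9 = 1 by omega]; decide

/-- Reading an `ℤ/9` congruence as equality of `% 9` residues. [folklore] -/
theorem emod_nine_eq_of_zmod_eq {a b : ℤ} (h : (a : ZMod 9) = (b : ZMod 9)) : a % 9 = b % 9 :=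
  (ZMod.intCast_eq_intCast_iff a b 9).mp h

end Tables

/-! ### §3 `a_w` across the `±3`-twists on the principal-series rows -/

section Twist

variable (V W : WeierstrassCurve ℚ) [V.IsElliptic] [V.IsGloballyMinimal] [W.IsElliptic] [W.IsGloballyMinimal]

/-- **`a_w` across a `±3`-twist on the principal-series rows.** For `V` on a PS row of K1/K2 (`ClassO6 V 3`,
`v₃Δ_min` even, `Δ′ ≡ 1 (mod 3)`) and `C • V^{(d)} = W` with `d = ±3` (both globally minimal):
`a_w(W) = (−d/3)·… ` precisely **`a_w(W) = a_w(V)` if `d = −3` and `a_w(W) = −a_w(V)` if `d = 3`.**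
Ingredients: `v ↦ v ± 6` (`PSTwistInvolution.padicValInt_minimalDiscriminantInt_twist_of_cyclic`),
`Δ′ mod 9` preserved (`minimalDiscUnitPartThree_twist_zmod_nine`), `c₆ᵘ ↦ (d/3)·c₆ᵘ (mod 9)` (§1), the four-row
closed form `psUntwistedTrace_of_psRow` on both sides, and `s(−x) = −s(x)`, `T(−x) = −T(x)` (§2).
[cite: Kraus1990, Théorème (p = 3)] [cite: SilvermanAEC2009, X.2 Prop. 2.4] -/
theorem psUntwistedTrace_twist_of_psRow (hO6 : ClassO6 V 3) (hev : Even (padicValInt 3 V.minimalDiscriminantInt))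
    (hps : V.minimalDiscriminantInt / 3 ^ padicValInt 3 V.minimalDiscriminantInt % 3 = 1)
    {d : ℤ} (hd : d = 3 ∨ d = -3) (C : VariableChange ℚ) (hC : C • V.quadraticTwist (d : ℚ) = W) :
    W.psUntwistedTrace = -(d / 3) * V.psUntwistedTrace := by
  obtain ⟨hO6W, hevW, hpsW⟩ := PSTwistInvolution.psRow_twist_of_psRow V W hO6 hev hps hd C hC
  have hps' : minimalDiscUnitPartThree V % 3 = 1 := hps
  have hpsW' : minimalDiscUnitPartThree W % 3 = 1 := hpsW
  have hV0 := integralModelInt_c₆_ne_zero_of_even V hO6.2.1 hO6.2.2 hev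
  have hW0 := integralModelInt_c₆_ne_zero_of_even W hO6W.2.1 hO6W.2.2 hevW
  have hfV := (PSKodairaDictionary.condExp_eq_four_iff_even V hO6.2.1 hO6.2.2).mpr hev
  have hfW := (PSKodairaDictionary.condExp_eq_four_iff_even W hO6W.2.1 hO6W.2.2).mpr hevW
  -- residues across the twist
  have hΔ9 : minimalDiscUnitPartThree W % 9 = minimalDiscUnitPartThree V % 9 :=
    emod_nine_eq_of_zmod_eq (PSTwistInvolution.minimalDiscUnitPartThree_twist_zmod_nine V W hd C hC)
  have hc9 := c₆_unitPart_twist_zmod_nine V W hd C hC hV0 hW0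
  set cV := (integralModelInt V).c₆ / 3 ^ padicValInt 3 (integralModelInt V).c₆ with hcVdef
  set cW := (integralModelInt W).c₆ / 3 ^ padicValInt 3 (integralModelInt W).c₆ with hcWdef
  obtain ⟨y, hy, hy3⟩ := PSRootNumberThreeTable.exists_eq_pow_mul_not_dvd hV0
  have hcVy : cV = y := Int.ediv_eq_of_eq_mul_right (pow_ne_zero _ (by norm_num)) hy
  rw [psUntwistedTrace_of_psRow W hO6W hevW hpsW, psUntwistedTrace_of_psRow V hO6 hev hps]
  rw [← hcVdef, ← hcWdef, hΔ9]
  rcases hd with rfl | rfl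
  · -- `d = 3`: `c₆ᵘ(W) ≡ c₆ᵘ(V)`, `v ↦ v ± 6`: every branch changes sign
    have hc : cW % 9 = cV % 9 := by
      refine emod_nine_eq_of_zmod_eq ?_
      rw [hc9]; push_cast; ring
    rw [hc, show (-((3 : ℤ) / 3)) = -1 by norm_num]
    rcases PSTwistInvolution.padicValInt_minimalDiscriminantInt_twist_of_cyclic V W hO6 hev (Or.inl rfl) C hC with
      ⟨hv, hw, -⟩ | ⟨hv, hw, -⟩ | ⟨hv, hw, -⟩ | ⟨hv, hw, -⟩ <;> rw [hv, hw] <;> norm_num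
  · -- `d = −3`: `c₆ᵘ(W) ≡ −c₆ᵘ(V)`, `v ↦ v ± 6`: the two sign changes cancel
    have hc : cW % 9 = (-cV) % 9 := by
      refine emod_nine_eq_of_zmod_eq ?_
      rw [hc9]; push_cast; ring
    rw [hc, show (-((-3 : ℤ) / 3)) = 1 by norm_num, one_mul]
    rcases PSTwistInvolution.padicValInt_minimalDiscriminantInt_twist_of_cyclic V W hO6 hev (Or.inr rfl) C hC with
      ⟨hv, hw, -⟩ | ⟨hv, hw, -⟩ | ⟨hv, hw, -⟩ | ⟨hv, hw, -⟩ <;> rw [hv, hw]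
    · -- `4 ↦ 10`
      have h45 := c₆_unitPart_emod_nine_of_psRow_II_IVstar V hfV (Or.inl hv) hps'
      rw [← hcVdef] at h45
      norm_num [signNine_neg_emod h45]
    · -- `6 ↦ 12`
      norm_num [traceTableIV_neg_emod (by rw [hcVy]; exact hy3 : ¬ (3 : ℤ) ∣ cV)]
    · -- `10 ↦ 4`
      have h45 := c₆_unitPart_emod_nine_of_psRow_II_IVstar V hfV (Or.inr hv) hps'
      rw [← hcVdef] at h45
      norm_num [signNine_neg_emod h45]
    · -- `12 ↦ 6`
      norm_num [traceTableIV_neg_emod (by rw [hcVy]; exact hy3 : ¬ (3 : ℤ) ∣ cV)]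

/-- **`a_w` is constant on `χ₋₃`-twist pairs**: `C • V^{(−3)} = W` on a PS row ⟹ `a_w(W) = a_w(V)` — the kernel
shadow of «one untwist newform `g`, one root `α`, per pair» (LAW L-tw3 reading). [cite: Kraus1990, Théorème (p = 3)]
[cite: Rohrlich1994CRM, §19] -/
theorem psUntwistedTrace_twist_negThree_of_psRow (hO6 : ClassO6 V 3)
    (hev : Even (padicValInt 3 V.minimalDiscriminantInt))
    (hps : V.minimalDiscriminantInt / 3 ^ padicValInt 3 V.minimalDiscriminantInt % 3 = 1)
    (C : VariableChange ℚ) (hC : C • V.quadraticTwist ((-3 : ℤ) : ℚ) = W) :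
    W.psUntwistedTrace = V.psUntwistedTrace := by
  have h := psUntwistedTrace_twist_of_psRow V W hO6 hev hps (Or.inr rfl) C hC
  norm_num at h
  exact h

/-- **`a_w` is odd under the `χ₃`-twist**: `C • V^{(3)} = W` on a PS row ⟹ `a_w(W) = −a_w(V)` (`E ⊗ χ₃` is the
`χ₋₁`-twist of the `χ₋₃`-partner; over `ℚ₃(ζ₉) ∋ √−3` that is the unramified quadratic twist of the good
special fibre, which negates the Frobenius trace — LAW L-a3 (C)). [cite: Kraus1990, Théorème (p = 3)]
[cite: Rohrlich1994CRM, §19] -/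
theorem psUntwistedTrace_twist_three_of_psRow (hO6 : ClassO6 V 3)
    (hev : Even (padicValInt 3 V.minimalDiscriminantInt))
    (hps : V.minimalDiscriminantInt / 3 ^ padicValInt 3 V.minimalDiscriminantInt % 3 = 1)
    (C : VariableChange ℚ) (hC : C • V.quadraticTwist ((3 : ℤ) : ℚ) = W) :
    W.psUntwistedTrace = -V.psUntwistedTrace := by
  have h := psUntwistedTrace_twist_of_psRow V W hO6 hev hps (Or.inl rfl) C hC
  norm_num at h
  exact h

/-- **The `a_w = 0` sub-row is a union of `χ₋₃`-pairs and of `χ₃`-pairs**: `a_w(W) = 0 ↔ a_w(V) = 0` across any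
`±3`-twist on the PS rows. [cite: Kraus1990, Théorème (p = 3)] -/
theorem psUntwistedTrace_eq_zero_iff_twist_of_psRow (hO6 : ClassO6 V 3)
    (hev : Even (padicValInt 3 V.minimalDiscriminantInt))
    (hps : V.minimalDiscriminantInt / 3 ^ padicValInt 3 V.minimalDiscriminantInt % 3 = 1)
    {d : ℤ} (hd : d = 3 ∨ d = -3) (C : VariableChange ℚ) (hC : C • V.quadraticTwist (d : ℚ) = W) :
    W.psUntwistedTrace = 0 ↔ V.psUntwistedTrace = 0 := by
  rw [psUntwistedTrace_twist_of_psRow V W hO6 hev hps hd C hC]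
  rcases hd with rfl | rfl <;> norm_num

end Twist

end Summit.BirchSwinnertonDyer.BirchSwinnertonDyer.Theorems.PSUntwistedTrace
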